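import Summits.Ventures.PercRepro.C041ZoneOCubeDefs
import Summits.Ventures.PercRepro.C041ZoneZSkelINV

/-!
# (O-CUBE) is the ZONE O-CUBE of the skeleton zone (p6, gen 27; C-041.md §5, §14 (a))

Setting of `C041ZoneZSkelINV` and `C041ZoneOCubeDefs`.  The O-cube sum of a bare colouring `O` (`oCube`, gen 24: the sum
of `3·[Good_a] + 3·[Good_b] − 2` over the sources of `O ∪ X` for `X ⊆ B(O)`) is the sum of `gdWeight` over the VALID
cube states of `O` (`oCube_eq_sum_valid_cube`: a source of `O ∪ X` is a valid cube state and a valid cube state is a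
source of `O ∪ X` for `X` its opened interior edges).  On the skeleton zone with the single anchor `c` (and the
protected anchor `c`): `Good_a ⟺ G1` and `Good_b ⟺ G2` for a cube state (`skel_G1_iff`, `skel_G2_iff` — a red walk
from the probe to a terminal avoiding the blue cluster of the other terminal is a red bare walk inside the non-deleted
vertices ending with a red terminal edge), and validity is `Valid` (`skel_valid_iff`); so `gdWeight = ocWeight` on the
valid cube states and the O-cube sum is the ZONE O-CUBE sum (`oCube_eq_zoneOCubeF`).

* **`oCubeConj_iff_zoneOCube`** — mine-3's CONJECTURE (O-CUBE) (`OCubeConj`, gen 24) for the skeleton `(G; a, b, c)`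
  is exactly the ZONE O-CUBE conjecture (`ZoneOCubeConjF`) on its skeleton zones with anchor `c`: the open crux of
  ROW C-041 is an instance of the abstract conjecture of C-041.md §14 (a).
-/

namespace PercRepro

namespace MultiGraph

open Finset ZoneZ ZoneZ.ZoneData

variable {V E : Type*} {G : MultiGraph V E} {a b c : V}

section Sources

variable [Fintype V] [Fintype E] [DecidableEq E] (hc : c ≠ a ∧ c ≠ b) (hne : a ≠ b) (O : Config E)

omit [Fintype V] in
/-- A source of `O ∪ X` (`X ⊆ B(O)`) is a cube state of `O`. -/
theorem isCubeState_of_isSrcO {X : Finset E} (hX : X ⊆ G.interiorSet a b O) {S : Config E}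
    (hS : G.IsSrcO a b c (rcOpenEdges O X) S) : G.IsCubeState a b c O S := by
  classical
  obtain ⟨hagree, _, hadm⟩ := hS
  refine ⟨fun e he hO => ?_, fun e he hO hS => ?_, hadm⟩
  · rw [hagree e he]
    unfold rcOpenEdges
    rw [hO]
    rfl
  · rw [hagree e he] at hS
    unfold rcOpenEdges at hS
    rw [hO] at hS
    have hX' : e ∈ X := by
      by_contra h
      rw [decide_eq_false h] at hS
      exact absurd hS (by decide)
    have := hX hX'
    unfold interiorSet at this
    rw [Finset.mem_filter] at this
    exact this.2

variable (G a b) in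
open Classical in
/-- The opened interior edges of a state. -/
noncomputable def openedSet (S : Config E) : Finset E := (G.interiorSet a b O).filter fun e => S e = true

omit [Fintype V] in
/-- A valid cube state of `O` is a source of `O ∪ X` for `X` its opened interior edges. -/
theorem isSrcO_openedSet {S : Config E} (hS : G.IsCubeState a b c O S) (hvalid : ¬ G.RcInvalid a b c S) :
    G.IsSrcO a b c (rcOpenEdges O (G.openedSet a b O S)) S := by
  classical
  refine ⟨fun e he => ?_, ?_, hS.2.2⟩
  · unfold rcOpenEdges openedSet
    cases hO : O e
    · cases hSe : S e
      · have hmem : e ∉ (G.interiorSet a b O).filter (fun e => S e = true) := by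
          rw [Finset.mem_filter]
          rintro ⟨_, h⟩
          rw [hSe] at h
          exact absurd h (by decide)
        rw [decide_eq_false hmem]
        rfl
      · have hmem : e ∈ (G.interiorSet a b O).filter (fun e => S e = true) := by
          rw [Finset.mem_filter]
          refine ⟨?_, hSe⟩
          unfold interiorSet
          rw [Finset.mem_filter]
          exact ⟨Finset.mem_univ _, hS.2.1 e he hO hSe⟩
        rw [decide_eq_true hmem]
        rfl
    · rw [hS.1 e he hO]
      rfl
  · unfold RcInvalid at hvalid
    exact not_not.1 hvalid

omit [Fintype V] in
/-- The opened set of a source of `O ∪ X` is `X`. -/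
theorem openedSet_of_isSrcO {X : Finset E} (hX : X ⊆ G.interiorSet a b O) {S : Config E}
    (hS : G.IsSrcO a b c (rcOpenEdges O X) S) : G.openedSet a b O S = X := by
  classical
  ext e
  unfold openedSet
  rw [Finset.mem_filter]
  constructor
  · rintro ⟨he, hSe⟩
    have he' := he
    unfold interiorSet at he'
    rw [Finset.mem_filter] at he'
    rw [hS.1 e he'.2.1] at hSe
    unfold rcOpenEdges at hSe
    rw [he'.2.2.1] at hSe
    by_contra h
    rw [decide_eq_false h] at hSe
    exact absurd hSe (by decide)
  · intro heX
    have he := hX heX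
    refine ⟨he, ?_⟩
    have he' := he
    unfold interiorSet at he'
    rw [Finset.mem_filter] at he'
    rw [hS.1 e he'.2.1]
    unfold rcOpenEdges
    rw [decide_eq_true heX]
    cases O e <;> rfl

omit [Fintype V] in
open Classical in
/-- **The O-cube sum is the sum of the weights over the valid cube states.** -/
theorem oCube_eq_sum_valid_cube :
    G.oCube a b c O = ∑ S ∈ (G.cubeStateSet a b c O).filter (fun S => ¬ G.RcInvalid a b c S), G.gdWeight a b c S := by
  unfold oCube sumF
  rw [Finset.sum_sigma']
  refine Finset.sum_nbij' (fun p => p.2) (fun S => ⟨G.openedSet a b O S, S⟩) ?_ ?_ ?_ ?_ ?_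
  · rintro ⟨X, S⟩ hp
    rw [Finset.mem_sigma, Finset.mem_powerset] at hp
    obtain ⟨hX, hS⟩ := hp
    unfold srcSetO at hS
    rw [Finset.mem_filter] at hS
    rw [Finset.mem_filter]
    unfold cubeStateSet
    rw [Finset.mem_filter]
    refine ⟨⟨Finset.mem_univ _, isCubeState_of_isSrcO O hX hS.2⟩, ?_⟩
    unfold RcInvalid
    exact not_not.2 hS.2.2.1
  · intro S hS
    rw [Finset.mem_filter] at hS
    obtain ⟨hS, hvalid⟩ := hS
    unfold cubeStateSet at hS
    rw [Finset.mem_filter] at hS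
    rw [Finset.mem_sigma, Finset.mem_powerset]
    refine ⟨Finset.filter_subset _ _, ?_⟩
    unfold srcSetO
    rw [Finset.mem_filter]
    exact ⟨Finset.mem_univ _, isSrcO_openedSet O hS.2 hvalid⟩
  · rintro ⟨X, S⟩ hp
    rw [Finset.mem_sigma, Finset.mem_powerset] at hp
    obtain ⟨hX, hS⟩ := hp
    unfold srcSetO at hS
    rw [Finset.mem_filter] at hS
    simp only
    rw [openedSet_of_isSrcO O hX hS.2]
  · intro S _
    rfl
  · intro p _
    rfl

end Sources

section Good

variable [Fintype V] [Fintype E] [DecidableEq E] (hc : c ≠ a ∧ c ≠ b) (O S : Config E)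

include hc

omit [Fintype V] [Fintype E] [DecidableEq E] in
/-- A red bare walk from the probe avoiding the blue cluster of `a` ends in `REACH {c}` (the probe not deleted). -/
theorem skel_mem_REACH_singleton_of_bareWalkAvoiding (hadm : ¬ G.Conn Sᶜ a b)
    (hcD : c ∉ (G.skelZone a b O).D (G.toState a b S)) {w : V}
    (hw : Relation.ReflTransGen (fun x y => G.BareAdj a b S x y ∧ y ∉ G.cluster Sᶜ a) c w) :
    w ∈ (G.skelZone a b O).REACH {c} (G.toState a b S) := by
  unfold ZoneData.REACH ZoneData.reachIn
  induction hw with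
  | refl => exact mem_reach_of_mem ⟨rfl, hcD⟩
  | tail hpre hxy ih =>
    have hx' := ne_terminal_of_bareReach (bareWalk_of_avoiding a b hpre) hc
    have hy' := ne_terminal_of_bareReach (bareWalk_of_avoiding a b (hpre.tail hxy)) hc
    have hyD : _ ∉ (G.skelZone a b O).D (G.toState a b S) :=
      (skel_not_mem_cluster_iff O S hadm hy').1 hxy.2
    exact reach_tail ih ⟨(skel_redAdj_iff O S hx').2 hxy.1, reachIn_subset ih, hyD⟩

omit [Fintype V] [Fintype E] [DecidableEq E] in
/-- The vertices of `REACH {c}` are non-terminals red-bare-reached from the probe inside the non-deleted vertices. -/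
theorem skel_walk_of_mem_REACH_singleton (hadm : ¬ G.Conn Sᶜ a b) {w : V}
    (hw : w ∈ (G.skelZone a b O).REACH {c} (G.toState a b S)) :
    Relation.ReflTransGen (fun x y => G.OpenAdj S x y ∧ y ∉ G.cluster Sᶜ a) c w ∧ (w ≠ a ∧ w ≠ b) := by
  obtain ⟨s, ⟨hs, _⟩, h⟩ := hw
  rw [Set.mem_singleton_iff] at hs
  subst hs
  induction h with
  | refl => exact ⟨Relation.ReflTransGen.refl, hc⟩
  | tail _ hxy ih =>
    obtain ⟨hxy, _, hyD⟩ := hxy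
    have hxy' := (skel_redAdj_iff O S ih.2).1 hxy
    have hy' : _ ≠ a ∧ _ ≠ b := (ne_of_bare_joins hxy'.choose_spec.1 hxy'.choose_spec.2.2).2
    exact ⟨ih.1.tail ⟨hxy'.openAdj, (skel_not_mem_cluster_iff O S hadm hy').2 hyD⟩, hy'⟩

omit [Fintype V] [Fintype E] [DecidableEq E] in
/-- **`Good_a` is `G1`** on the skeleton zone with anchor `c`, for a cube state. -/
theorem skel_G1_iff (hS : G.IsCubeState a b c O S) :
    (G.skelZone a b O).G1 {c} (G.toState a b S) ↔ G.WalkAvoiding S (G.cluster Sᶜ a) c b := by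
  have hadm : ¬ G.Conn Sᶜ a b := hS.2.2.2.2
  constructor
  · rintro ⟨w, hwR, hwMt⟩
    obtain ⟨hwalk, hw'⟩ := skel_walk_of_mem_REACH_singleton hc O S hadm hwR
    obtain ⟨_, e, hj, hSe⟩ := (skel_mem_Mt_iff O S w).1 hwMt
    have hcD : c ∉ G.cluster Sᶜ a := by
      obtain ⟨s, ⟨hs, hsD⟩, _⟩ := hwR
      rw [Set.mem_singleton_iff] at hs
      subst hs
      exact (skel_not_mem_cluster_iff O S hadm hc).2 hsD
    refine ⟨hcD, hwalk.tail ⟨⟨e, hSe, hj⟩, ?_⟩⟩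
    rw [mem_cluster]
    exact hadm
  · intro hg
    obtain ⟨w, hw, _, e, hSe, hj⟩ := exists_bareWalkAvoiding_of_goodA a b c hc hg
    have hw' : w ≠ a ∧ w ≠ b := ne_terminal_of_bareReach (bareWalk_of_avoiding a b hw) hc
    have hcD : c ∉ (G.skelZone a b O).D (G.toState a b S) := (skel_not_mem_cluster_iff O S hadm hc).1 hg.1
    exact ⟨w, skel_mem_REACH_singleton_of_bareWalkAvoiding hc O S hadm hcD hw,
      (skel_mem_Mt_iff O S w).2 ⟨hw', e, hj, hSe⟩⟩

end Good

end MultiGraph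

end PercRepro
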